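import Summits.QuantumFields.QCD.Theses.NestedDissectionSea

/-!
# Helper for stub `stub_windowDefectFloor` of line `proper-time-quarantine`
(crux `Summit.QuantumFields.QCD.Theses.NestedDissectionSea.SeaFactorisationBridge`,
item stmt-QuantumFields-13880): the window crossing floor IS the physical branch, modulo the hinge

The lead's skeleton (reshape r2) splits plan stub 5 (the physical branch
`∀ fl, ∀ᶠ k, -1 < m_crit(k) + a_k m_fl / Z_m(k)` from the hinge `CoerciveAt`) into the CLOSED
reduction `physicalBranch_of_floor : CoerciveAt → WindowDefectFloor → branch` and the OPEN stub 5a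
`stub_windowDefectFloor : CoerciveAt → WindowDefectFloor`, where `WindowDefectFloor` is the
"window crossing floor below the physical line": if at step `k` the valence mass of flavour `fl`
sits at or below `-1`, then on every odd torus of physical side `≥ ℓ` some admissible window cell
carries a sign defect with phase-quenched probability `≥ p₀ > 0`.

This file records, in TREE vocabulary (no skeleton definitions; the `let`-telescope below is
VERBATIM that of clause (ii) of `CoerciveSea`), that stub 5a is EXACTLY the branch lemma in
disguise — neither easier nor harder:

* `windowDefectFloor_of_branch` — the CONVERSE of the reduction, with no hypothesis at all: under
  the branch the antecedent `m_fl(k) ≤ -1` of the floor is eventually false, so the floor holds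
  (vacuously, with `p₀ := 1`);
* `branch_of_windowDefectFloor` — the reduction itself with only clause (ii) of the hinge (windowed
  local dilution, at some physical size `R`) as hypothesis: with `ε := p₀/2`, at a step `k` where a
  valence mass is `≤ -1`, on a torus of physical side `≥ max R ℓ`, the floor cell has
  `p₀ ≤ P ≤ δ_j` and every octave `j' < J` has the admissible cube of side `b₀ 2^{j'}`
  (`window_admissible_cube`), so `δ_{j'} ≥ P(cube) ≥ 0` and `p₀ ≤ Σ_{j<J} δ_j ≤ p₀/2` — absurd;
* `windowDefectFloor_iff_branch` — both: GIVEN clause (ii), `WindowDefectFloor ↔ branch`.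

Consequence for planning: `CoerciveAt → WindowDefectFloor` and `CoerciveAt → branch` are
interderivable by pure logic, so stub 5a asks for a genuinely new LOWER bound on window sign-defect
probability below the physical line (a `χ_t > 0`-type input), or equivalently for a branch clause
`∀ᶠ k, -1 ≤ reg.mcrit k` on the hinge; no clause of `CoerciveSea`/`EarlyCrosserLaw` (upper bounds
and the parity pin) supplies either.
-/

noncomputable section

namespace Summit.QuantumFields.QCD.Cruxes.SeaFactorisationBridge.ProperTimeQuarantine

open scoped BigOperators Classical
open Filter MeasureTheory
open Literature.MathematicalPhysics.QuantumFieldTheory Literature.MathematicalPhysics.QuantumLattice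
open Literature.Probability.LatticeModels

/-- **The window crossing floor from the physical branch** (converse of the skeleton's
`physicalBranch_of_floor`, no hypothesis): if every valence mass is eventually `> -1`, the floor's
antecedent `m_crit(k) + a_k m_fl / Z_m(k) ≤ -1` is eventually false, so the floor holds with
`p₀ := 1`. -/
theorem windowDefectFloor_of_branch :
    ∀ (Nf : ℕ) (reg : QCDRegularisation Nf) (b₀ : ℕ) (ℓ : ℝ) (m : Fin Nf → ℝ),
      (∀ fl : Fin Nf, ∀ᶠ k : ℕ in Filter.atTop, -1 < reg.mcrit k + reg.a k * m fl / reg.Zm k) →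
        ∃ p₀ : ℝ, 0 < p₀ ∧ ∀ fl : Fin Nf, ∀ᶠ k : ℕ in Filter.atTop, reg.mcrit k + reg.a k * m fl / reg.Zm k ≤ -1 → ∀ S : ℕ, ℓ ≤ reg.a k * (2 * S + 1) → let N : ℕ := 2 * S + 1; let mq : Fin Nf → ℝ := fun f => reg.mcrit k + reg.a k * m f / reg.Zm k; let wt : GaugeConfig 4 N (Matrix.specialUnitaryGroup (Fin 3) ℂ) → ℝ := fun U => ∏ f, ‖fermionDet (wilsonDirac (fundamentalRep (Fin 3)) U (mq f) 1)‖; let P : (GaugeConfig 4 N (Matrix.specialUnitaryGroup (Fin 3) ℂ) → Prop) → ℝ := fun E => (∫ U, (if E U then (1 : ℝ) else 0) * wt U ∂(wilsonMeasure (d := 4) (L := N) (fundamentalRep (Fin 3)) (reg.β k))) / (∫ U, wt U ∂(wilsonMeasure (d := 4) (L := N) (fundamentalRep (Fin 3)) (reg.β k))); let J : ℕ := Nat.log 2 (⌊ℓ / reg.a k⌋₊ / b₀) + 1; ∃ j, j < J ∧ ∃ s : Fin 4 → ℕ, (∀ i, b₀ * 2 ^ j ≤ s i ∧ s i < b₀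 * 2 ^ (j + 2) ∧ s i ≤ N ∧ (s i : ℝ) * reg.a k ≤ ℓ) ∧ p₀ ≤ P (fun U => ∃ f, IsSignDefect U (mq f) j s) := by
  intro Nf reg b₀ ℓ m hbr
  refine ⟨1, one_pos, fun fl => ?_⟩
  filter_upwards [hbr fl] with k hk hle
  exact absurd hle (not_le.2 hk)

/-- Every positive real is below `a_k (2S+1)` for some `S` (torus sizes are unbounded). -/
private theorem exists_torus_ge' {Nf : ℕ} (reg : QCDRegularisation Nf) (k : ℕ) (R : ℝ) :
    ∃ S : ℕ, R ≤ reg.a k * (2 * S + 1) := by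
  obtain ⟨n, hn⟩ := exists_nat_ge (R / reg.a k)
  have ha := reg.a_pos k
  have hn' : R ≤ (n : ℝ) * reg.a k := by rwa [div_le_iff₀ ha] at hn
  have hn0 : (0 : ℝ) ≤ (n : ℝ) * reg.a k := mul_nonneg (Nat.cast_nonneg n) ha.le
  exact ⟨n, by nlinarith⟩

/-- At every step `k` with `a_k b₀ ≤ ℓ ≤ a_k (2S+1)`, EVERY octave `j < J` of the window has an
admissible cell, namely the cube of side `b₀ 2^j` (so clause (ii) pins `δ_j ≥ 0` there). -/
theorem window_admissible_cube {Nf : ℕ} (reg : QCDRegularisation Nf) {b₀ : ℕ} (hb₀ : 2 ≤ b₀)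
    {ℓ : ℝ} {k S j : ℕ} (hkb : reg.a k * b₀ ≤ ℓ) (hℓS : ℓ ≤ reg.a k * (2 * S + 1))
    (hj : j < Nat.log 2 (⌊ℓ / reg.a k⌋₊ / b₀) + 1) :
    ∀ i : Fin 4, b₀ * 2 ^ j ≤ (fun _ : Fin 4 => b₀ * 2 ^ j) i ∧
      (fun _ : Fin 4 => b₀ * 2 ^ j) i < b₀ * 2 ^ (j + 2) ∧
      (fun _ : Fin 4 => b₀ * 2 ^ j) i ≤ 2 * S + 1 ∧
      (((fun _ : Fin 4 => b₀ * 2 ^ j) i : ℕ) : ℝ) * reg.a k ≤ ℓ := by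
  intro i
  have ha := reg.a_pos k
  have hb0 : 0 < b₀ := by omega
  have hbfloor : b₀ ≤ ⌊ℓ / reg.a k⌋₊ := by
    refine Nat.le_floor ?_
    rw [le_div_iff₀ ha]
    simpa [mul_comm] using hkb
  have hn : ⌊ℓ / reg.a k⌋₊ / b₀ ≠ 0 := by
    have : 1 ≤ ⌊ℓ / reg.a k⌋₊ / b₀ := (Nat.one_le_div_iff hb0).2 hbfloor
    omega
  have hpow : 2 ^ j ≤ ⌊ℓ / reg.a k⌋₊ / b₀ :=
    (Nat.pow_le_pow_right (by norm_num) (Nat.lt_succ_iff.1 hj)).trans (Nat.pow_log_le_self 2 hn)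
  have hcube : b₀ * 2 ^ j ≤ ⌊ℓ / reg.a k⌋₊ :=
    (Nat.mul_le_mul_left b₀ hpow).trans (Nat.mul_div_le _ _)
  have hℓ0 : 0 ≤ ℓ := le_trans (by positivity) hkb
  have hfloor_le : (⌊ℓ / reg.a k⌋₊ : ℝ) ≤ ℓ / reg.a k := Nat.floor_le (div_nonneg hℓ0 ha.le)
  refine ⟨le_rfl, ?_, ?_, ?_⟩
  · exact Nat.mul_lt_mul_of_pos_left (Nat.pow_lt_pow_right (by norm_num) (by omega)) hb0
  · have h1 : (⌊ℓ / reg.a k⌋₊ : ℝ) ≤ (2 * S + 1 : ℕ) := by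
      refine hfloor_le.trans ?_
      rw [div_le_iff₀ ha]
      push_cast
      linarith
    exact hcube.trans (by exact_mod_cast h1)
  · have h1 : ((b₀ * 2 ^ j : ℕ) : ℝ) ≤ ⌊ℓ / reg.a k⌋₊ := by exact_mod_cast hcube
    calc ((b₀ * 2 ^ j : ℕ) : ℝ) * reg.a k ≤ (ℓ / reg.a k) * reg.a k := by
          exact mul_le_mul_of_nonneg_right (h1.trans hfloor_le) ha.le
      _ = ℓ := by field_simp

/-- **The physical branch from the window crossing floor, GIVEN clause (ii) of the hinge** (the
skeleton's `physicalBranch_of_floor` with `CoerciveAt` weakened to its windowed-dilution clause at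
some physical size `R`; sorry-free, standard axioms).  With `ε := p₀/2` in (ii), at a step `k` where
a valence mass is `≤ -1`, on a torus of physical side `≥ max R ℓ`: the floor cell has
`p₀ ≤ P ≤ δ_j`, every octave `j' < J` has `δ_{j'} ≥ P(cube) ≥ 0` (`window_admissible_cube`), so
`p₀ ≤ Σ_{j<J} δ_j ≤ p₀/2` — absurd. -/
theorem branch_of_windowDefectFloor :
    ∀ (Nf : ℕ) (reg : QCDRegularisation Nf) (b₀ : ℕ) (ℓ : ℝ) (m : Fin Nf → ℝ), 2 ≤ b₀ → 0 < ℓ →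
      ∀ R : ℝ, (∀ ε : ℝ, 0 < ε → ∀ᶠ k : ℕ in Filter.atTop, ∀ S : ℕ, R ≤ reg.a k * (2 * S + 1) → let N : ℕ := 2 * S + 1; let mq : Fin Nf → ℝ := fun f => reg.mcrit k + reg.a k * m f / reg.Zm k; let wt : GaugeConfig 4 N (Matrix.specialUnitaryGroup (Fin 3) ℂ) → ℝ := fun U => ∏ f, ‖fermionDet (wilsonDirac (fundamentalRep (Fin 3)) U (mq f) 1)‖; let P : (GaugeConfig 4 N (Matrix.specialUnitaryGroup (Fin 3) ℂ) → Prop) → ℝ := fun E => (∫ U, (if E U then (1 : ℝ) else 0) * wt U ∂(wilsonMeasure (d := 4) (L := N) (fundamentalRep (Fin 3)) (reg.β k))) / (∫ U, wt U ∂(wilsonMeasure (d := 4) (L := N) (fundamentalRep (Fin 3)) (reg.β k))); let J : ℕ := Nat.log 2 (⌊ℓ / reg.a k⌋₊ / b₀) + 1; ∃ δ : ℕ → ℝ, ∑ j ∈ Finset.range J, δ j ≤ ε ∧ ∀ j < J, ∀ s : Fin 4 → ℕ, (∀ i, b₀ * 2 ^ j ≤ s i ∧ s i < b₀ * 2 ^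 (j + 2) ∧ s i ≤ N ∧ (s i : ℝ) * reg.a k ≤ ℓ) → P (fun U => ∃ f, IsSignDefect U (mq f) j s) ≤ δ j) →
        (∃ p₀ : ℝ, 0 < p₀ ∧ ∀ fl : Fin Nf, ∀ᶠ k : ℕ in Filter.atTop, reg.mcrit k + reg.a k * m fl / reg.Zm k ≤ -1 → ∀ S : ℕ, ℓ ≤ reg.a k * (2 * S + 1) → let N : ℕ := 2 * S + 1; let mq : Fin Nf → ℝ := fun f => reg.mcrit k + reg.a k * m f / reg.Zm k; let wt : GaugeConfig 4 N (Matrix.specialUnitaryGroup (Fin 3) ℂ) → ℝ := fun U => ∏ f, ‖fermionDet (wilsonDirac (fundamentalRep (Fin 3)) U (mq f) 1)‖; let P : (GaugeConfig 4 N (Matrix.specialUnitaryGroup (Fin 3) ℂ) → Prop) → ℝ := fun E => (∫ U, (if E U then (1 : ℝ) else 0) * wt U ∂(wilsonMeasure (d := 4) (L := N) (fundamentalRep (Fin 3)) (reg.β k))) / (∫ U, wt U ∂(wilsonMeasure (d := 4) (L := N) (fundamentalRep (Fin 3)) (reg.β k))); let J : ℕ := Nat.log 2 (⌊ℓ / reg.a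 k⌋₊ / b₀) + 1; ∃ j, j < J ∧ ∃ s : Fin 4 → ℕ, (∀ i, b₀ * 2 ^ j ≤ s i ∧ s i < b₀ * 2 ^ (j + 2) ∧ s i ≤ N ∧ (s i : ℝ) * reg.a k ≤ ℓ) ∧ p₀ ≤ P (fun U => ∃ f, IsSignDefect U (mq f) j s)) →
          ∀ fl : Fin Nf, ∀ᶠ k : ℕ in Filter.atTop, -1 < reg.mcrit k + reg.a k * m fl / reg.Zm k := by
  intro Nf reg b₀ ℓ m hb₀ hℓ R hii hF fl
  obtain ⟨p₀, hp₀, hfloor⟩ := hF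
  have hkb : ∀ᶠ k : ℕ in atTop, reg.a k * b₀ ≤ ℓ := by
    have ht : Tendsto (fun k => reg.a k * b₀) atTop (nhds 0) := by
      simpa using reg.tendsto_a.mul_const (b₀ : ℝ)
    exact (ht.eventually (Iio_mem_nhds hℓ)).mono fun k hk => le_of_lt hk
  filter_upwards [hii (p₀ / 2) (half_pos hp₀), hfloor fl, hkb] with k hk hfl hkb'
  by_contra hle
  push Not at hle
  obtain ⟨S, hS⟩ := exists_torus_ge' reg k (max R ℓ)
  have hRS : R ≤ reg.a k * (2 * S + 1) := (le_max_left _ _).trans hS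
  have hℓS : ℓ ≤ reg.a k * (2 * S + 1) := (le_max_right _ _).trans hS
  have hk' := hk S hRS
  have hfl' := hfl hle S hℓS
  dsimp only at hk' hfl'
  obtain ⟨δ, hsum, hP⟩ := hk'
  obtain ⟨j, hj, s, hs, hp⟩ := hfl'
  have hδj : p₀ ≤ δ j := hp.trans (hP j hj s hs)
  have hδnn : ∀ j' ∈ Finset.range (Nat.log 2 (⌊ℓ / reg.a k⌋₊ / b₀) + 1), 0 ≤ δ j' := by
    intro j' hj'
    rw [Finset.mem_range] at hj'
    refine le_trans ?_ (hP j' hj' (fun _ => b₀ * 2 ^ j') (window_admissible_cube reg hb₀ hkb' hℓS hj'))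
    refine div_nonneg (integral_nonneg fun U => ?_) (integral_nonneg fun U => ?_)
    · refine mul_nonneg ?_ (Finset.prod_nonneg fun _ _ => norm_nonneg _)
      split_ifs <;> norm_num
    · exact Finset.prod_nonneg fun _ _ => norm_nonneg _
  have hle_sum := Finset.single_le_sum hδnn (Finset.mem_range.2 hj)
  linarith

/-- **`WindowDefectFloor ↔ branch` modulo the hinge**: given clause (ii) of `CoerciveSea` at some
physical size `R` (and `2 ≤ b₀`, `0 < ℓ`), the window crossing floor below the physical line holds
iff every valence mass is eventually on the physical branch `> -1`.  So the open stub
`CoerciveAt → WindowDefectFloor` of the line is logically THE branch lemma `CoerciveAt → branch`. -/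
theorem windowDefectFloor_iff_branch :
    ∀ (Nf : ℕ) (reg : QCDRegularisation Nf) (b₀ : ℕ) (ℓ : ℝ) (m : Fin Nf → ℝ), 2 ≤ b₀ → 0 < ℓ →
      ∀ R : ℝ, (∀ ε : ℝ, 0 < ε → ∀ᶠ k : ℕ in Filter.atTop, ∀ S : ℕ, R ≤ reg.a k * (2 * S + 1) → let N : ℕ := 2 * S + 1; let mq : Fin Nf → ℝ := fun f => reg.mcrit k + reg.a k * m f / reg.Zm k; let wt : GaugeConfig 4 N (Matrix.specialUnitaryGroup (Fin 3) ℂ) → ℝ := fun U => ∏ f, ‖fermionDet (wilsonDirac (fundamentalRep (Fin 3)) U (mq f) 1)‖; let P : (GaugeConfig 4 N (Matrix.specialUnitaryGroup (Fin 3) ℂ) → Prop) → ℝ := fun E => (∫ U, (if E U then (1 : ℝ) else 0) * wt U ∂(wilsonMeasure (d := 4) (L := N) (fundamentalRep (Fin 3)) (reg.β k))) / (∫ U, wt U ∂(wilsonMeasure (d := 4) (L := N) (fundamentalRep (Fin 3)) (reg.β k))); let J : ℕ := Nat.log 2 (⌊ℓ / reg.a k⌋₊ / b₀) + 1; ∃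 δ : ℕ → ℝ, ∑ j ∈ Finset.range J, δ j ≤ ε ∧ ∀ j < J, ∀ s : Fin 4 → ℕ, (∀ i, b₀ * 2 ^ j ≤ s i ∧ s i < b₀ * 2 ^ (j + 2) ∧ s i ≤ N ∧ (s i : ℝ) * reg.a k ≤ ℓ) → P (fun U => ∃ f, IsSignDefect U (mq f) j s) ≤ δ j) →
        ((∃ p₀ : ℝ, 0 < p₀ ∧ ∀ fl : Fin Nf, ∀ᶠ k : ℕ in Filter.atTop, reg.mcrit k + reg.a k * m fl / reg.Zm k ≤ -1 → ∀ S : ℕ, ℓ ≤ reg.a k * (2 * S + 1) → let N : ℕ := 2 * S + 1; let mq : Fin Nf → ℝ := fun f => reg.mcrit k + reg.a k * m f / reg.Zm k; let wt : GaugeConfig 4 N (Matrix.specialUnitaryGroup (Fin 3) ℂ) → ℝ := fun U => ∏ f, ‖fermionDet (wilsonDirac (fundamentalRep (Fin 3)) U (mq f) 1)‖; let P : (GaugeConfig 4 N (Matrix.specialUnitaryGroup (Fin 3) ℂ) → Prop) → ℝ := fun E => (∫ U, (if E U then (1 : ℝ) else 0) * wt U ∂(wilsonMeasure (d := 4) (L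 := N) (fundamentalRep (Fin 3)) (reg.β k))) / (∫ U, wt U ∂(wilsonMeasure (d := 4) (L := N) (fundamentalRep (Fin 3)) (reg.β k))); let J : ℕ := Nat.log 2 (⌊ℓ / reg.a k⌋₊ / b₀) + 1; ∃ j, j < J ∧ ∃ s : Fin 4 → ℕ, (∀ i, b₀ * 2 ^ j ≤ s i ∧ s i < b₀ * 2 ^ (j + 2) ∧ s i ≤ N ∧ (s i : ℝ) * reg.a k ≤ ℓ) ∧ p₀ ≤ P (fun U => ∃ f, IsSignDefect U (mq f) j s)) ↔
          ∀ fl : Fin Nf, ∀ᶠ k : ℕ in Filter.atTop, -1 < reg.mcrit k + reg.a k * m fl / reg.Zm k) :=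
  fun Nf reg b₀ ℓ m hb₀ hℓ R hii =>
    ⟨branch_of_windowDefectFloor Nf reg b₀ ℓ m hb₀ hℓ R hii, windowDefectFloor_of_branch Nf reg b₀ ℓ m⟩

end Summit.QuantumFields.QCD.Cruxes.SeaFactorisationBridge.ProperTimeQuarantine

end
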